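import Mathlib.AlgebraicGeometry.EllipticCurve.Affine.Point
import Mathlib.Algebra.Module.Torsion.Field
import Mathlib.FieldTheory.IntermediateField.Adjoin.Basic
import Mathlib.FieldTheory.SeparableClosure
import Literature.NumberTheory.EllipticCurves.IsogenyHomProofs
import HarnessLib

/-!
# The degree of an isogeny: `deg φ = [K̄(E) : φ^* K̄(E')]`

Trunk T-ELLARITH (group G16); notion `cm_endomorphisms_isogeny`. Serves the named fact
`Literature.AlgebraicGeometry.Motives.linearIndependent_tateModule_map` of `Literature.AlgebraicGeometry.Motives.FaltingsEC`
(Silverman, *AEC*, Thm. III.7.4) through the "degree route" of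
`Literature.AlgebraicGeometry.Motives.FaltingsECProofs`
(`Literature.AlgebraicGeometry.Motives.linearIndependent_tateModule_map_of_degree`): what III.7.4 needs of the geometry of
isogenies is a function `deg` on `Hom_K(E, E')` which is a positive definite quadratic form
(*AEC* Cor. III.6.3) with `#ker φ ∣ deg φ` (*AEC* Thm. III.4.10(a)). This file **defines** that
function — Silverman's degree of an isogeny, the degree of the extension of function fields
`K̄(E) / φ^* K̄(E')` (*AEC* III.§4, p. 66; II.§2, p. 21) — for the isogenies of the prelude
`Literature.NumberTheory.EllipticCurves.Isogeny`, and vendors the three printed results about it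
that the degree route consumes, as named facts over this real definition.

## Contents (all definitions are real)

* `WeierstrassCurve.geomFunctionField W = K̄(E)`: Mathlib's function field
  `Frac(K̄[x, y] / (Weierstrass polynomial))` of `E = W / K̄` (`WeierstrassCurve.Affine.FunctionField`
  of the base change to `K̄ = AlgebraicClosure K`).
* `WeierstrassCurve.evalGeneric W : K̄[x, y] →+* K̄(E)`, `g ↦ g(x, y)`: evaluation of two-variable
  polynomials at the generic point, with the dictionary "`g(x, y) = 0` in `K̄(E)` iff `g` vanishes
  at every (equivalently, at infinitely many) affine points of `E(K̄)`"
  (`evalGeneric_eq_zero_iff`, `evalGeneric_eq_zero_of_infinite`; from the tree's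
  `WeierstrassCurve.finite_setOf_evalEval_eq_zero`).
* `WeierstrassCurve.RationalRep f`: the data `(P₁, Q₁, P₂, Q₂)` of a rational map
  `(P₁/Q₁, P₂/Q₂)` agreeing with `f : E(K̄) → E'(K̄)` off a finite set (a witness of the prelude's
  `IsAlgebraicOn W W' f`), with `pullbackX r = P₁(x, y)/Q₁(x, y) = x' ∘ f` and
  `pullbackY r = y' ∘ f` in `K̄(E)`; these do **not** depend on the representation
  (`RationalRep.pullbackX_eq`, `pullbackY_eq`) and satisfy the equation of `E'`
  (`RationalRep.equation`), giving the point `f(x, y) ∈ E'(K̄(E))` (`RationalRep.genericImage`;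
  Silverman's "`φ(x₁, y₁) ∈ E₂(K(x₁, y₁))`", proof of Thm. III.6.2(c)).
* For an isogeny `φ : Isogeny W W'`: `φ.pullbackX = φ^* x'`, `φ.pullbackY = φ^* y'`,
  `φ.pullbackField = φ^* K̄(E') = K̄(φ^* x', φ^* y') ⊆ K̄(E)` (an `IntermediateField`),
  **`φ.deg = [K̄(E) : φ^* K̄(E')]`** (`Module.finrank`), `φ.genericImage ∈ E'(K̄(E))`.
* `WeierstrassCurve.degHom W W' : Hom(E(K̄), E'(K̄)) → ℤ`: `deg` on the maps underlying isogenies,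
  `0` elsewhere (in particular `deg 0 = 0`, Silverman's convention, III.§4 p. 66), the shape in
  which `FaltingsECProofs` consumes a degree function.
* Named facts (`def … : Prop`, D-0014), each quantifying `[W.IsElliptic] [W'.IsElliptic]`:
  * `WeierstrassCurve.Isogeny.finiteDimensional_pullbackField` — *AEC* Thm. II.2.4(a):
    `K̄(E) / φ^* K̄(E')` is a finite extension;
  * `WeierstrassCurve.Isogeny.card_ker_eq_finSepDegree` — *AEC* Thm. III.4.10(a) (at `Q = O`):
    `#ker φ = deg_s φ`, the separable degree `[K̄(E) : φ^* K̄(E')]_s` (Mathlib `Field.finSepDegree`);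
  * `WeierstrassCurve.degHom_isQuadraticForm` — *AEC* Cor. III.6.3: `deg` is a quadratic form on
    `Hom_K(E, E')` in Silverman's sense (III.§6, Definition before Cor. III.6.3: `d(-α) = d(α)` and
    `(α, β) ↦ d(α + β) - d(α) - d(β)` bilinear).
* Proved consequences: `Isogeny.deg_pos` (from II.2.4(a)), `Isogeny.card_ker_dvd_deg`
  (`deg_s ∣ deg`, from III.4.10(a)), `degHom_parallelogram` (the parallelogram law, from III.6.3),
  `degHom_toAddMonoidHom`, `degHom_zero`.

## Faithfulness of the encoding

An `Isogeny W W'` of the prelude is an additive map on `K̄`-points agreeing off a finite set with a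
rational map `(P₁/Q₁, P₂/Q₂)`, `Pᵢ, Qᵢ ∈ K̄[x, y]`; it is the map on points of the morphism of
curves `φ` extending that rational map (*AEC* II.2.1, III.4.8; see the prelude's docstring), and
`φ^* : K̄(E') → K̄(E)`, `φ^* g = g ∘ φ` (*AEC* II.§2, p. 20) sends the Weierstrass coordinates
`x', y'` of `E'` to `P₁(x, y)/Q₁(x, y)` and `P₂(x, y)/Q₂(x, y)`. Since `K̄(E') = K̄(x', y')`, the
image `φ^* K̄(E')` is the subfield `K̄(φ^* x', φ^* y')` of `K̄(E)`, which is `Isogeny.pullbackField`;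
so `Isogeny.deg` is literally Silverman's `deg φ` (III.§4, p. 66: "the degree of the finite
extension `K̄(E₁)/φ^* K̄(E₂)`"), and `Field.finSepDegree φ.pullbackField K̄(E)` is his `deg_s φ`.
The elements `φ^* x', φ^* y'` are defined through a *chosen* representation `(P₁, Q₁, P₂, Q₂)` but
are independent of it (`pullbackX_eq`, `pullbackY_eq`: two representations agree at infinitely
many points, and a polynomial with infinitely many zeros on `E(K̄)` is zero in `K̄(E)`).
The prelude's `Isogeny.degree` is `#ker φ`, i.e. `deg_s φ` by III.4.10(a); it is not used here.
III.6.3 is printed for `Hom(E₁, E₂) = Hom_{K̄}`; its restriction to the subgroup `Hom_K(E, E')`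
(`WeierstrassCurve.homModule`, equal to `{0} ∪ {isogenies over K}` by the tree's theorem
`WeierstrassCurve.mem_homModule_iff_holds`) is what is vendored, with `deg 0 = 0`.

## Mathlib

Mathlib has the coordinate ring and function field of a Weierstrass curve
(`WeierstrassCurve.Affine.CoordinateRing`, `.FunctionField`, with `CoordinateRing.basis`, the norm
to `K[X]` and `Affine.Point.toClass`), intermediate fields, `Module.finrank`, `Field.finSepDegree`
(`Field.finSepDegree_dvd_finrank`), but no morphisms of curves, no `φ^*` and no degree of a map of
curves (searched: `rg -i "isogen|degree of a morphism"` in `Mathlib/AlgebraicGeometry/EllipticCurve`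
finds nothing relevant).

## References

* [SilvermanAEC2009] J. H. Silverman, *The Arithmetic of Elliptic Curves*, 2nd ed., GTM 106,
  Springer 2009: II.§2 (pp. 20–21: `φ^*`, Thm. II.2.4, `deg`, `deg_s`, `deg_i`), III.§4 (p. 66:
  degree of an isogeny, `deg [0] = 0`; Thm. III.4.10, p. 70), III.§6 (Definition of quadratic form
  and Cor. III.6.3, p. 80; proof of Thm. III.6.2(c), p. 79), III.§7 (Thm. III.7.4).

## Design choices

* `noncomputable section`, `open scoped Classical`, `K : Type u`, dot-notation extensions in
  `namespace WeierstrassCurve`, as in the preludes.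
* Everything is over `K̄ = AlgebraicClosure K`, the field of definition of the prelude's rational
  maps; Silverman defines `deg` over `K̄` as well (III.§4).
* `pullbackField` is an `IntermediateField K̄ K̄(E)` rather than the range of a ring map
  `K̄(E') →+* K̄(E)`: the degree and separable degree only need the subfield, and this keeps the
  definition free of the (provable, but longer) verification that `x' ↦ φ^* x', y' ↦ φ^* y'`
  extends to an embedding of `K̄(E')`; `RationalRep.equation` is the key input for that extension.
-/

noncomputable section

open scoped Classical
open scoped Polynomial.Bivariate
open Polynomial

universe u

namespace WeierstrassCurve

variable {K : Type u} [Field K]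

/-! ## The function field `K̄(E)` and evaluation at the generic point -/

section FunctionField

variable (W : WeierstrassCurve K)

/-- The function field `K̄(E) = Frac(K̄[x, y]/(W(x, y)))` of `E = W` over `K̄ = AlgebraicClosure K`
(Mathlib's `WeierstrassCurve.Affine.FunctionField` of the base change). Silverman, *AEC*, I.§1,
II.§1–2, III.§3. [folklore] -/
abbrev geomFunctionField : Type u :=
  (W.baseChange (AlgebraicClosure K)).toAffine.FunctionField

/-- **Evaluation at the generic point**: the ring map `K̄[x, y] → K̄(E)`, `g ↦ g(x, y)` (through
Mathlib's identification `MvPolynomial (Fin 2) K̄ ≃ K̄[X][Y]`, the quotient map to the coordinate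
ring and the map to its fraction field). [folklore] -/
def evalGeneric : MvPolynomial (Fin 2) (AlgebraicClosure K) →+* W.geomFunctionField :=
  (algebraMap (W.baseChange (AlgebraicClosure K)).toAffine.CoordinateRing W.geomFunctionField).comp
    ((Affine.CoordinateRing.mk (W.baseChange (AlgebraicClosure K)).toAffine).comp
      (Polynomial.Bivariate.equivMvPolynomial (AlgebraicClosure K)).symm.toRingHom)

variable {W}

/-- Unfolding `evalGeneric`. [folklore] -/
theorem evalGeneric_apply (g : MvPolynomial (Fin 2) (AlgebraicClosure K)) :
    W.evalGeneric g = algebraMap _ W.geomFunctionField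
      (Affine.CoordinateRing.mk (W.baseChange (AlgebraicClosure K)).toAffine
        ((Polynomial.Bivariate.equivMvPolynomial (AlgebraicClosure K)).symm g)) :=
  rfl

/-- `evalGeneric` is the structure map on constants. [folklore] -/
theorem evalGeneric_C (c : AlgebraicClosure K) :
    W.evalGeneric (MvPolynomial.C c) = algebraMap (AlgebraicClosure K) W.geomFunctionField c := by
  rw [evalGeneric_apply]
  have : (Polynomial.Bivariate.equivMvPolynomial (AlgebraicClosure K)).symm (MvPolynomial.C c) =
      Polynomial.C (Polynomial.C c) := by
    simp [Polynomial.Bivariate.equivMvPolynomial]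
  rw [this, IsScalarTower.algebraMap_apply (AlgebraicClosure K)
    (W.baseChange (AlgebraicClosure K)).toAffine.CoordinateRing W.geomFunctionField]
  congr 1

open geomPoints in
/-- **A polynomial with infinitely many zeros on `E(K̄)` is zero in `K̄(E)`** (it is then divisible
by the Weierstrass polynomial: the tree's `WeierstrassCurve.finite_setOf_evalEval_eq_zero`).
Silverman, *AEC*, II.1.2 (a non-zero function has finitely many zeros). [folklore] -/
theorem evalGeneric_eq_zero_of_infinite {g : MvPolynomial (Fin 2) (AlgebraicClosure K)}
    (hg : {P : W.geomPoints | P ≠ 0 ∧ MvPolynomial.eval (xy P) g = 0}.Infinite) :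
    W.evalGeneric g = 0 := by
  set g₂ : (AlgebraicClosure K)[X][Y] :=
    (Polynomial.Bivariate.equivMvPolynomial (AlgebraicClosure K)).symm g with hg₂
  by_cases h0 : Affine.CoordinateRing.mk (W.baseChange (AlgebraicClosure K)).toAffine g₂ = 0
  · rw [evalGeneric_apply, ← hg₂, h0, map_zero]
  · exfalso
    refine hg ((finite_setOf_evalEval_eq_zero (W.baseChange (AlgebraicClosure K)) h0).subset ?_)
    rintro P ⟨hP0, hPg⟩
    cases P with
    | zero => exact (hP0 rfl).elim
    | some x' y' h' =>
      rw [xy_some, eval_eq_evalEval_equivMvPolynomial_symm] at hPg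
      exact ⟨x', y', h', rfl, hPg⟩

open geomPoints in
/-- If `g(x, y) = 0` in `K̄(E)` then `g` vanishes at every affine point of `E(K̄)` (the coordinate
ring embeds in its fraction field, and `g` is divisible by the Weierstrass polynomial).
[folklore] -/
theorem eval_xy_eq_zero_of_evalGeneric_eq_zero {g : MvPolynomial (Fin 2) (AlgebraicClosure K)}
    (hg : W.evalGeneric g = 0) {P : W.geomPoints} (hP : P ≠ 0) : MvPolynomial.eval (xy P) g = 0 := by
  rw [evalGeneric_apply] at hg
  have h0 := (FaithfulSMul.algebraMap_injective
    (W.baseChange (AlgebraicClosure K)).toAffine.CoordinateRing W.geomFunctionField)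
    (hg.trans (map_zero _).symm)
  obtain ⟨r, hr⟩ := AdjoinRoot.mk_eq_zero.mp h0
  cases P with
  | zero => exact (hP rfl).elim
  | some x y h =>
    rw [xy_some, eval_eq_evalEval_equivMvPolynomial_symm, hr, evalEval_mul]
    have : (W.baseChange (AlgebraicClosure K)).toAffine.polynomial.evalEval x y = 0 := h.1
    rw [this, zero_mul]

/-- The set of affine points of `E(K̄)` is infinite (`E(K̄)` is, by the tree's
`geomPoints.instInfinite`). [folklore] -/
theorem geomPoints.infinite_ne_zero [W.IsElliptic] : {P : W.geomPoints | P ≠ 0}.Infinite := by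
  have : {P : W.geomPoints | P ≠ 0} = ({0} : Set W.geomPoints)ᶜ := by ext; simp
  rw [this]
  exact (Set.finite_singleton 0).infinite_compl

/-- Outside any finite subset of `E(K̄)` there is an affine point. [folklore] -/
theorem geomPoints.exists_not_mem_of_finite [W.IsElliptic] {S : Set W.geomPoints}
    (hS : S.Finite) : ∃ P : W.geomPoints, P ∉ S ∧ P ≠ 0 := by
  obtain ⟨P, hP, hPS⟩ := (geomPoints.infinite_ne_zero.sdiff hS).nonempty
  exact ⟨P, hPS, hP⟩

open _root_.WeierstrassCurve.geomPoints in
/-- **`g(x, y) = 0` in `K̄(E)` iff `g` vanishes at every affine point of `E(K̄)`** (`E` elliptic,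
so that `E(K̄)` is infinite). Silverman, *AEC*, I.§1 (`K̄[V] = K̄[X]/I(V)`), II.1.2. [folklore] -/
theorem evalGeneric_eq_zero_iff [W.IsElliptic] {g : MvPolynomial (Fin 2) (AlgebraicClosure K)} :
    W.evalGeneric g = 0 ↔ ∀ P : W.geomPoints, P ≠ 0 → MvPolynomial.eval (xy P) g = 0 := by
  refine ⟨fun h P hP ↦ eval_xy_eq_zero_of_evalGeneric_eq_zero h hP, fun h ↦ ?_⟩
  apply evalGeneric_eq_zero_of_infinite
  convert geomPoints.infinite_ne_zero (W := W) using 1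
  ext P
  simp only [Set.mem_setOf_eq, and_iff_left_iff_imp]
  exact h P

open _root_.WeierstrassCurve.geomPoints in
/-- If `g` vanishes at the affine points off a finite subset of `E(K̄)` then `g(x, y) = 0` in
`K̄(E)`. Silverman, *AEC*, II.1.2. [folklore] -/
theorem evalGeneric_eq_zero_of_finite [W.IsElliptic] {g : MvPolynomial (Fin 2) (AlgebraicClosure K)}
    {S : Set W.geomPoints} (hS : S.Finite)
    (h : ∀ P ∉ S, P ≠ 0 → MvPolynomial.eval (xy P) g = 0) : W.evalGeneric g = 0 := by
  apply evalGeneric_eq_zero_of_infinite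
  have : {P : W.geomPoints | P ≠ 0} \ S ⊆
      {P : W.geomPoints | P ≠ 0 ∧ MvPolynomial.eval (xy P) g = 0} := by
    rintro P ⟨hP, hPS⟩
    exact ⟨hP, h P hPS hP⟩
  exact (geomPoints.infinite_ne_zero.sdiff hS).mono this

open _root_.WeierstrassCurve.geomPoints in
/-- If `g` does not vanish at some affine point then `g(x, y) ≠ 0` in `K̄(E)`. [folklore] -/
theorem evalGeneric_ne_zero_of_eval_ne_zero {g : MvPolynomial (Fin 2) (AlgebraicClosure K)}
    {P : W.geomPoints} (hP : P ≠ 0) (h : MvPolynomial.eval (xy P) g ≠ 0) : W.evalGeneric g ≠ 0 :=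
  fun h0 ↦ h (eval_xy_eq_zero_of_evalGeneric_eq_zero h0 hP)

end FunctionField

/-! ## Clearing denominators in the Weierstrass equation -/

section Clear

variable (V : WeierstrassCurve (AlgebraicClosure K))
  (P₁ Q₁ P₂ Q₂ : MvPolynomial (Fin 2) (AlgebraicClosure K))

/-- The Weierstrass polynomial of `V` at `(P₁/Q₁, P₂/Q₂)` with denominators cleared, i.e.
multiplied by `Q₁³ Q₂²`: a polynomial in `K̄[x, y]`. [folklore] -/
def clearedWeierstrass : MvPolynomial (Fin 2) (AlgebraicClosure K) :=
  P₂ ^ 2 * Q₁ ^ 3 + MvPolynomial.C V.a₁ * P₁ * P₂ * Q₁ ^ 2 * Q₂ +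
      MvPolynomial.C V.a₃ * P₂ * Q₁ ^ 3 * Q₂ -
    (P₁ ^ 3 * Q₂ ^ 2 + MvPolynomial.C V.a₂ * P₁ ^ 2 * Q₁ * Q₂ ^ 2 +
      MvPolynomial.C V.a₄ * P₁ * Q₁ ^ 2 * Q₂ ^ 2 + MvPolynomial.C V.a₆ * Q₁ ^ 3 * Q₂ ^ 2)

variable {V P₁ Q₁ P₂ Q₂} in
/-- Under a ring map `e` to a field extending the structure map of `K̄` and not killing `Q₁, Q₂`,
the cleared polynomial goes to `e(Q₁)³ e(Q₂)² · W_V(e P₁ / e Q₁, e P₂ / e Q₂)` (used with `e` the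
evaluation at a point of `E(K̄)` and with `e` the evaluation at the generic point). [folklore] -/
theorem map_clearedWeierstrass {L : Type*} [Field L] [Algebra (AlgebraicClosure K) L]
    (e : MvPolynomial (Fin 2) (AlgebraicClosure K) →+* L)
    (he : ∀ c, e (MvPolynomial.C c) = algebraMap (AlgebraicClosure K) L c)
    (h₁ : e Q₁ ≠ 0) (h₂ : e Q₂ ≠ 0) :
    e (clearedWeierstrass V P₁ Q₁ P₂ Q₂) = e Q₁ ^ 3 * e Q₂ ^ 2 *
      (V.map (algebraMap (AlgebraicClosure K) L)).toAffine.polynomial.evalEval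
        (e P₁ / e Q₁) (e P₂ / e Q₂) := by
  rw [Affine.evalEval_polynomial]
  simp only [clearedWeierstrass, map_add, map_sub, map_mul, map_pow, he, map_a₁, map_a₂, map_a₃,
    map_a₄, map_a₆]
  field_simp

end Clear

/-! ## Rational representations and the pull-backs `x' ∘ f`, `y' ∘ f` -/

/-- A **rational representation** of a map `f : E(K̄) → E'(K̄)`: polynomials
`P₁, Q₁, P₂, Q₂ ∈ K̄[x, y]` such that `f` agrees with the rational map `(P₁/Q₁, P₂/Q₂)` at all but
finitely many points (a witness of the prelude's `IsAlgebraicOn W W' f`).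
Silverman, *AEC*, I.§3 (rational maps), III.§4. [folklore] -/
structure RationalRep (W W' : WeierstrassCurve K) (f : W.geomPoints → W'.geomPoints) where
  /-- Numerator of the first coordinate. -/
  P₁ : MvPolynomial (Fin 2) (AlgebraicClosure K)
  /-- Denominator of the first coordinate. -/
  Q₁ : MvPolynomial (Fin 2) (AlgebraicClosure K)
  /-- Numerator of the second coordinate. -/
  P₂ : MvPolynomial (Fin 2) (AlgebraicClosure K)
  /-- Denominator of the second coordinate. -/
  Q₂ : MvPolynomial (Fin 2) (AlgebraicClosure K)
  /-- `f` agrees with `(P₁/Q₁, P₂/Q₂)` off a finite set. -/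
  finite : {P : W.geomPoints | ¬ AgreesWithRationalMapAt W W' P₁ Q₁ P₂ Q₂ f P}.Finite

namespace RationalRep

variable {W W' : WeierstrassCurve K} {f : W.geomPoints → W'.geomPoints} (r r' : RationalRep W W' f)

/-- A rational representation witnesses `IsAlgebraicOn`. [folklore] -/
theorem isAlgebraicOn (r : RationalRep W W' f) : IsAlgebraicOn W W' f :=
  ⟨r.P₁, r.Q₁, r.P₂, r.Q₂, r.finite⟩

/-- `x' ∘ f = P₁(x, y) / Q₁(x, y) ∈ K̄(E)`, the pull-back of the first Weierstrass coordinate of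
`E'`. Silverman, *AEC*, II.§2 (`φ^* f = f ∘ φ`). [folklore] -/
def pullbackX : W.geomFunctionField :=
  W.evalGeneric r.P₁ / W.evalGeneric r.Q₁

/-- `y' ∘ f = P₂(x, y) / Q₂(x, y) ∈ K̄(E)`, the pull-back of the second Weierstrass coordinate of
`E'`. Silverman, *AEC*, II.§2. [folklore] -/
def pullbackY : W.geomFunctionField :=
  W.evalGeneric r.P₂ / W.evalGeneric r.Q₂

variable [W.IsElliptic]

/-- The denominator `Q₁` is non-zero in `K̄(E)` (it is non-zero at a point of agreement, and such
points exist since `E(K̄)` is infinite). [folklore] -/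
theorem evalGeneric_Q₁_ne_zero : W.evalGeneric r.Q₁ ≠ 0 := by
  obtain ⟨P, hP, hP0⟩ := geomPoints.exists_not_mem_of_finite r.finite
  simp only [Set.mem_setOf_eq, not_not] at hP
  exact evalGeneric_ne_zero_of_eval_ne_zero hP0 (agreesWithRationalMapAt_iff.mp hP).2.1

/-- The denominator `Q₂` is non-zero in `K̄(E)`. [folklore] -/
theorem evalGeneric_Q₂_ne_zero : W.evalGeneric r.Q₂ ≠ 0 := by
  obtain ⟨P, hP, hP0⟩ := geomPoints.exists_not_mem_of_finite r.finite
  simp only [Set.mem_setOf_eq, not_not] at hP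
  exact evalGeneric_ne_zero_of_eval_ne_zero hP0 (agreesWithRationalMapAt_iff.mp hP).2.2.1

/-- **`x' ∘ f` does not depend on the rational representation**: two representations give the
same first coordinate at every common point of agreement, so `P₁ Q₁' - P₁' Q₁` has infinitely many
zeros on `E(K̄)` and vanishes in `K̄(E)`. Silverman, *AEC*, I.§3 (a rational map determines its
components in `K̄(C)`). [folklore] -/
theorem pullbackX_eq : r.pullbackX = r'.pullbackX := by
  rw [pullbackX, pullbackX, div_eq_div_iff r.evalGeneric_Q₁_ne_zero r'.evalGeneric_Q₁_ne_zero,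
    ← map_mul, ← map_mul, ← sub_eq_zero, ← map_sub]
  refine evalGeneric_eq_zero_of_finite (r.finite.union r'.finite) fun P hP hP0 ↦ ?_
  simp only [Set.mem_union, Set.mem_setOf_eq, not_or, not_not] at hP
  obtain ⟨-, hQ₁, -, h₁, e₁⟩ := agreesWithRationalMapAt_iff.mp hP.1
  obtain ⟨-, hQ₁', -, h₁', e₁'⟩ := agreesWithRationalMapAt_iff.mp hP.2
  have := (Affine.Point.some.inj (e₁.symm.trans e₁')).1
  rw [div_eq_div_iff hQ₁ hQ₁'] at this
  simp only [map_sub, map_mul]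
  rw [this, sub_self]

/-- **`y' ∘ f` does not depend on the rational representation.** [folklore] -/
theorem pullbackY_eq : r.pullbackY = r'.pullbackY := by
  rw [pullbackY, pullbackY, div_eq_div_iff r.evalGeneric_Q₂_ne_zero r'.evalGeneric_Q₂_ne_zero,
    ← map_mul, ← map_mul, ← sub_eq_zero, ← map_sub]
  refine evalGeneric_eq_zero_of_finite (r.finite.union r'.finite) fun P hP hP0 ↦ ?_
  simp only [Set.mem_union, Set.mem_setOf_eq, not_or, not_not] at hP
  obtain ⟨-, -, hQ₂, h₁, e₁⟩ := agreesWithRationalMapAt_iff.mp hP.1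
  obtain ⟨-, -, hQ₂', h₁', e₁'⟩ := agreesWithRationalMapAt_iff.mp hP.2
  have := (Affine.Point.some.inj (e₁.symm.trans e₁')).2
  rw [div_eq_div_iff hQ₂ hQ₂'] at this
  simp only [map_sub, map_mul]
  rw [this, sub_self]

/-- **`(x' ∘ f, y' ∘ f)` satisfies the equation of `E'` in `K̄(E)`**: the cleared Weierstrass
polynomial of `E'` at `(P₁/Q₁, P₂/Q₂)` vanishes at every point of agreement (there `f P ∈ E'(K̄)`
has these coordinates), hence in `K̄(E)`, and `Q₁ Q₂ ≠ 0` there. Silverman, *AEC*, proof of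
Thm. III.6.2(c) ("`φ(x₁, y₁) ∈ E₂(K(x₁, y₁))`"). [folklore] -/
theorem equation : (W'.baseChange W.geomFunctionField).toAffine.Equation r.pullbackX r.pullbackY := by
  have key := map_clearedWeierstrass (V := W'.baseChange (AlgebraicClosure K)) (P₁ := r.P₁)
    (P₂ := r.P₂) W.evalGeneric evalGeneric_C r.evalGeneric_Q₁_ne_zero r.evalGeneric_Q₂_ne_zero
  have h0 : W.evalGeneric
      (clearedWeierstrass (W'.baseChange (AlgebraicClosure K)) r.P₁ r.Q₁ r.P₂ r.Q₂) = 0 := by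
    refine evalGeneric_eq_zero_of_finite r.finite fun P hP hP0 ↦ ?_
    simp only [Set.mem_setOf_eq, not_not] at hP
    obtain ⟨-, hQ₁, hQ₂, h', -⟩ := agreesWithRationalMapAt_iff.mp hP
    rw [map_clearedWeierstrass (V := W'.baseChange (AlgebraicClosure K)) (P₁ := r.P₁)
      (P₂ := r.P₂) (MvPolynomial.eval (geomPoints.xy P)) (fun c ↦ MvPolynomial.eval_C c) hQ₁ hQ₂,
      Algebra.algebraMap_self, WeierstrassCurve.map_id]
    have h'' : (W'.baseChange (AlgebraicClosure K)).toAffine.polynomial.evalEval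
        (MvPolynomial.eval (geomPoints.xy P) r.P₁ / MvPolynomial.eval (geomPoints.xy P) r.Q₁)
        (MvPolynomial.eval (geomPoints.xy P) r.P₂ / MvPolynomial.eval (geomPoints.xy P) r.Q₂) =
        0 := h'.1
    rw [h'', mul_zero]
  have hmap : (W'.baseChange (AlgebraicClosure K)).map
      (algebraMap (AlgebraicClosure K) W.geomFunctionField) = W'.baseChange W.geomFunctionField :=
    WeierstrassCurve.map_baseChange W'
      (IsScalarTower.toAlgHom K (AlgebraicClosure K) W.geomFunctionField)
  rw [h0, hmap] at key
  exact (mul_eq_zero.mp key.symm).resolve_left (mul_ne_zero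
    (pow_ne_zero _ r.evalGeneric_Q₁_ne_zero) (pow_ne_zero _ r.evalGeneric_Q₂_ne_zero))

/-- `(x' ∘ f, y' ∘ f)` is a nonsingular point of `E'` over `K̄(E)` (`E'` elliptic). [folklore] -/
theorem nonsingular [W'.IsElliptic] :
    (W'.baseChange W.geomFunctionField).toAffine.Nonsingular r.pullbackX r.pullbackY :=
  (Affine.equation_iff_nonsingular (W := W'.baseChange W.geomFunctionField)).mp r.equation

/-- **The point `f(x, y) ∈ E'(K̄(E))`** with coordinates `(x' ∘ f, y' ∘ f)`. Silverman, *AEC*,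
proof of Thm. III.6.2(c). [folklore] -/
def genericImage [W'.IsElliptic] : (W'.baseChange W.geomFunctionField).toAffine.Point :=
  .some r.pullbackX r.pullbackY r.nonsingular

/-- The generic image does not depend on the representation. [folklore] -/
theorem genericImage_eq [W'.IsElliptic] : r.genericImage = r'.genericImage := by
  simp only [genericImage, r.pullbackX_eq r', r.pullbackY_eq r']

end RationalRep

namespace IsAlgebraicOn

variable {W W' : WeierstrassCurve K} {f : W.geomPoints → W'.geomPoints}

/-- An algebraic map has a rational representation. [folklore] -/
theorem nonempty_rationalRep (hf : IsAlgebraicOn W W' f) : Nonempty (RationalRep W W' f) :=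
  let ⟨P₁, Q₁, P₂, Q₂, h⟩ := hf
  ⟨⟨P₁, Q₁, P₂, Q₂, h⟩⟩

/-- A chosen rational representation of an algebraic map (any two give the same pull-backs,
`RationalRep.pullbackX_eq`). [folklore] -/
def rationalRep (hf : IsAlgebraicOn W W' f) : RationalRep W W' f :=
  Classical.choice hf.nonempty_rationalRep

end IsAlgebraicOn

/-! ## The degree of an isogeny -/

namespace Isogeny

variable {W W' : WeierstrassCurve K} (φ : Isogeny W W')

/-- A chosen rational representation of an isogeny. [folklore] -/
def rationalRep : RationalRep W W' φ :=
  φ.isAlgebraic.rationalRep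

/-- `φ^* x' = x' ∘ φ ∈ K̄(E)`, the pull-back along `φ` of the first Weierstrass coordinate of `E'`.
Silverman, *AEC*, II.§2 (p. 20). [folklore] -/
def pullbackX : W.geomFunctionField :=
  φ.rationalRep.pullbackX

/-- `φ^* y' = y' ∘ φ ∈ K̄(E)`. Silverman, *AEC*, II.§2 (p. 20). [folklore] -/
def pullbackY : W.geomFunctionField :=
  φ.rationalRep.pullbackY

/-- `φ^* x'` may be computed from any rational representation of `φ`. [folklore] -/
theorem pullbackX_eq [W.IsElliptic] (r : RationalRep W W' φ) : φ.pullbackX = r.pullbackX :=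
  RationalRep.pullbackX_eq _ _

/-- `φ^* y'` may be computed from any rational representation of `φ`. [folklore] -/
theorem pullbackY_eq [W.IsElliptic] (r : RationalRep W W' φ) : φ.pullbackY = r.pullbackY :=
  RationalRep.pullbackY_eq _ _

/-- **`φ^* K̄(E') ⊆ K̄(E)`**, the subfield `K̄(φ^* x', φ^* y')` generated by the pull-backs of the
Weierstrass coordinates of `E'` (the image of `φ^* : K̄(E') → K̄(E)`, as `K̄(E') = K̄(x', y')`).
Silverman, *AEC*, II.§2 (p. 20), III.§4 (p. 66). [folklore] -/
def pullbackField : IntermediateField (AlgebraicClosure K) W.geomFunctionField :=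
  IntermediateField.adjoin _ {φ.pullbackX, φ.pullbackY}

/-- **The degree of an isogeny**, `deg φ = [K̄(E) : φ^* K̄(E')]` (as a `Module.finrank`; the
extension is finite by *AEC* Thm. II.2.4(a), vendored below as
`finiteDimensional_pullbackField`). Not to be confused with the prelude's `Isogeny.degree = #ker φ`,
which is the separable degree `deg_s φ` (Thm. III.4.10(a)). Silverman, *AEC*, III.§4 (p. 66),
II.§2 (p. 21). [folklore] -/
def deg : ℕ :=
  Module.finrank φ.pullbackField W.geomFunctionField

/-- `(φ^* x', φ^* y')` satisfies the equation of `E'` in `K̄(E)`. Silverman, *AEC*, proof of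
Thm. III.6.2(c). [folklore] -/
theorem equation_pullback [W.IsElliptic] :
    (W'.baseChange W.geomFunctionField).toAffine.Equation φ.pullbackX φ.pullbackY :=
  φ.rationalRep.equation

/-- `(φ^* x', φ^* y')` is a nonsingular point of `E'` over `K̄(E)`. [folklore] -/
theorem nonsingular_pullback [W.IsElliptic] [W'.IsElliptic] :
    (W'.baseChange W.geomFunctionField).toAffine.Nonsingular φ.pullbackX φ.pullbackY :=
  φ.rationalRep.nonsingular

/-- **`φ(x, y) ∈ E'(K̄(E))`**, the image of the generic point of `E` ("another way of saying that
`φ` is an isogeny", Silverman, *AEC*, proof of Thm. III.6.2(c), p. 79). [folklore] -/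
def genericImage [W.IsElliptic] [W'.IsElliptic] : (W'.baseChange W.geomFunctionField).toAffine.Point :=
  .some φ.pullbackX φ.pullbackY φ.nonsingular_pullback

end Isogeny

/-! ## `deg` on `Hom(E(K̄), E'(K̄))` and the three named facts -/

section Facts

variable (W W' : WeierstrassCurve K)

/-- **`deg` as a function on all additive maps `E(K̄) → E'(K̄)`**: the degree of `φ` on the map
underlying an isogeny `φ` over `K` (which determines `φ`), and `0` elsewhere — in particular
`deg 0 = 0`, Silverman's convention (*AEC* III.§4, p. 66). This is the shape in which
`FaltingsECProofs` (`linearIndependent_tateModule_map_of_degree`) consumes the degree. [folklore] -/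
def degHom (f : W.geomPoints →+ W'.geomPoints) : ℤ :=
  if h : ∃ φ : Isogeny W W', φ.toAddMonoidHom = f then (h.choose.deg : ℤ) else 0

variable {W W'} in
/-- On (the map underlying) an isogeny, `degHom` is its degree. [folklore] -/
theorem degHom_toAddMonoidHom (φ : Isogeny W W') : degHom W W' φ.toAddMonoidHom = φ.deg := by
  have h : ∃ ψ : Isogeny W W', ψ.toAddMonoidHom = φ.toAddMonoidHom := ⟨φ, rfl⟩
  rw [degHom, dif_pos h]
  have : h.choose = φ := Isogeny.ext fun P ↦ by
    rw [← Isogeny.coe_toAddMonoidHom, h.choose_spec, Isogeny.coe_toAddMonoidHom]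
  rw [this]

variable {W W'} in
/-- Off the isogenies, `degHom` vanishes. [folklore] -/
theorem degHom_of_not_exists {f : W.geomPoints →+ W'.geomPoints}
    (h : ¬ ∃ φ : Isogeny W W', φ.toAddMonoidHom = f) : degHom W W' f = 0 := by
  rw [degHom, dif_neg h]

variable {W W'} in
/-- `deg 0 = 0` (the zero map has infinite kernel, so it underlies no isogeny).
Silverman, *AEC*, III.§4, p. 66. [folklore] -/
theorem degHom_zero [W.IsElliptic] : degHom W W' 0 = 0 := by
  refine degHom_of_not_exists ?_
  rintro ⟨φ, hφ⟩
  have hfin := φ.finite_ker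
  rw [hφ, AddMonoidHom.ker_zero] at hfin
  exact Set.infinite_univ (α := W.geomPoints) (by simpa using hfin)

/-- **Silverman, *AEC*, Thm. II.2.4(a)** for isogenies of elliptic curves: for a (non-constant)
isogeny `φ : E → E'`, `K̄(E)` is a finite extension of `φ^* K̄(E')`.
[cite: SilvermanAEC2009, Thm. II.2.4(a)] -/
def Isogeny.finiteDimensional_pullbackField : Prop :=
  ∀ [W.IsElliptic] [W'.IsElliptic] (φ : Isogeny W W'),
    FiniteDimensional φ.pullbackField W.geomFunctionField

/-- **Silverman, *AEC*, Thm. III.4.10(a)** (the case `Q = O` of "`#φ⁻¹(Q) = deg_s φ` for every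
`Q ∈ E₂`"): for a non-zero isogeny `φ : E → E'` of elliptic curves, `#ker φ = deg_s φ`, the
separable degree `[K̄(E) : φ^* K̄(E')]_s` (Mathlib's `Field.finSepDegree`).
[cite: SilvermanAEC2009, Thm. III.4.10(a)] -/
def Isogeny.card_ker_eq_finSepDegree : Prop :=
  ∀ [W.IsElliptic] [W'.IsElliptic] (φ : Isogeny W W'),
    Nat.card φ.toAddMonoidHom.ker = Field.finSepDegree φ.pullbackField W.geomFunctionField

/-- **Silverman, *AEC*, Cor. III.6.3: `deg` is a (positive definite) quadratic form on
`Hom(E₁, E₂)`**, in the sense of the Definition preceding it (III.§6, p. 80): (i)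
`deg (-φ) = deg φ` and (ii) the pairing `⟨φ, ψ⟩ = deg (φ + ψ) - deg φ - deg ψ` is bilinear — here on
the subgroup `Hom_K(E, E')` (`homModule W W'` inside `Hom(E(K̄), E'(K̄))`, with `deg 0 = 0`), with
(ii) spelled as additivity in the first variable (the pairing is symmetric). Positive definiteness
((iii), (iv) loc. cit.) holds by construction once the degree is finite (`degHom_pos`).
[cite: SilvermanAEC2009, Cor. III.6.3] -/
def degHom_isQuadraticForm : Prop :=
  ∀ [W.IsElliptic] [W'.IsElliptic],
    (∀ f ∈ homModule W W', degHom W W' (-f) = degHom W W' f) ∧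
    ∀ f ∈ homModule W W', ∀ g ∈ homModule W W', ∀ h ∈ homModule W W',
      degHom W W' (f + g + h) - degHom W W' (f + g) - degHom W W' h =
        (degHom W W' (f + h) - degHom W W' f - degHom W W' h) +
          (degHom W W' (g + h) - degHom W W' g - degHom W W' h)

variable {W W'} [W.IsElliptic] [W'.IsElliptic]

/-- `deg φ ≥ 1` (given the finiteness II.2.4(a), hypothesis `hfin`; Silverman, *AEC*, III.§4:
positive definiteness (iii)–(iv) of Cor. III.6.3 on non-zero isogenies). [folklore] -/
theorem Isogeny.deg_pos (hfin : Isogeny.finiteDimensional_pullbackField W W') (φ : Isogeny W W') :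
    0 < φ.deg := by
  haveI := hfin φ
  haveI : Module.IsTorsionFree φ.pullbackField W.geomFunctionField :=
    DivisionSemiring.to_moduleIsTorsionFree
  exact Module.finrank_pos

/-- **`#ker φ ∣ deg φ`**: `#ker φ = deg_s φ` (III.4.10(a), hypothesis `h`) divides
`deg φ = deg_s φ · deg_i φ` (Mathlib `Field.finSepDegree_dvd_finrank`). Silverman, *AEC*,
Thm. III.4.10(a), II.§2 (p. 21). [folklore] -/
theorem Isogeny.card_ker_dvd_deg (h : Isogeny.card_ker_eq_finSepDegree W W') (φ : Isogeny W W') :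
    Nat.card φ.toAddMonoidHom.ker ∣ φ.deg := by
  rw [h φ]
  exact Field.finSepDegree_dvd_finrank _ _

/-- `degHom f ≥ 1` for `f ≠ 0` in `Hom_K(E, E')` (given II.2.4(a), hypothesis `hfin`): such an
`f` underlies an isogeny (`WeierstrassCurve.mem_homModule_iff_holds`). Silverman, *AEC*,
Cor. III.6.3 (iii)–(iv). [folklore] -/
theorem degHom_pos (hfin : Isogeny.finiteDimensional_pullbackField W W')
    {f : W.geomPoints →+ W'.geomPoints} (hf : f ∈ homModule W W') (hf0 : f ≠ 0) :
    0 < degHom W W' f := by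
  rcases (mem_homModule_iff_holds W W' f).mp hf with h | ⟨φ, rfl⟩
  · exact (hf0 h).elim
  · rw [degHom_toAddMonoidHom]
    exact_mod_cast φ.deg_pos hfin

/-- **The parallelogram law `deg (f + g) + deg (f - g) = 2 deg f + 2 deg g` on `Hom_K(E, E')`**
from Cor. III.6.3 (hypothesis `h`): with `B(f, g) = deg (f + g) - deg f - deg g` additive in `f`
and `deg` even, `B(-g, f) = -B(g, f)`, whence the claim. This is the form of III.6.3 consumed by
`Literature.AlgebraicGeometry.Motives.linearIndependent_tateModule_map_of_degree`. [folklore] -/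
theorem degHom_parallelogram (h : degHom_isQuadraticForm W W')
    {f g : W.geomPoints →+ W'.geomPoints} (hf : f ∈ homModule W W') (hg : g ∈ homModule W W') :
    degHom W W' (f + g) + degHom W W' (f - g) = 2 * degHom W W' f + 2 * degHom W W' g := by
  obtain ⟨heven, hadd⟩ := @h _ _
  have h0 : degHom W W' 0 = 0 := degHom_zero
  have h1 := hadd g hg (-g) (neg_mem hg) f hf
  rw [add_neg_cancel, zero_add, h0, heven g hg] at h1
  rw [show f - g = -g + f by abel, add_comm f g]
  omega

end Facts

end WeierstrassCurve
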